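/-
Copyright: cell `langlands-arthur-audit` (papers/Langlands/langlands-arthur-audit), unit `pub-arthur-carver-g2`.
Staged for the tree under `Literature/NumberTheory/Automorphic/KMSW2014/` — to be filed AFTER
`Mok2015/DependencyDag.lean` and `KMSW2014/DependencyDag.lean` have landed (it imports both).
-/
import HarnessLib
import Literature.NumberTheory.Automorphic.Mok2015.DependencyDag
import Literature.NumberTheory.Automorphic.KMSW2014.DependencyDag

/-!
# KMSW (2014) composed with Mok (2015): the joint dependency DAG

Kaletha–Mínguez–Shin–White "take on faith the main results of [Mok]" (arXiv:1409.3731v3 main.tex l.69) — the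
list of `chap1mainthms.tex` l.9-19, "The numbering for the lemmas and theorems below is as in that paper" — and
conversely their Appendix A is the justification of "[Mok, Proposition 8.2.5]" ("stated … but without
justification. In Appendix A we prove this", l.21).  This file records the two DICTIONARY EDGES between the node
sets of `Mok2015.Nodes` and `KMSW2014.Nodes` and composes the bookkeeping theorems of the two modules: Mok's
section edges + supplies + leaves and KMSW's chapter edges + supplies + leaves ⟹ KMSW's proved scope at every
rank, so that the COMPLETE leaf set under KMSW's results is displayed (in particular the three STILL-UNWRITTEN
inputs: the general and the non-standard weighted fundamental lemmas under Mok — through the twisted weighted FL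
and the ordinary stabilisation for non-split U_{E/F}(N) — and the general weighted FL again under KMSW's own
untwisted stabilisation for inner twists; plus the sequels [KMS_A], [KMS_B] for the starred statements in full).
Nothing is asserted: every edge is a hypothesis.  No Mathlib, no `axiom`, no `sorry`.
-/

set_option autoImplicit false

namespace Literature.NumberTheory.Automorphic.KMSW2014

/-- D1 (dictionary edge Mok → KMSW): each item of KMSW's import list is one of Mok's main theorems or an
intermediate result of Mok §§3, 5, 7 at the relevant rank — Thms 2.4.2, 2.4.10, 2.5.2, 2.5.4, 5.1.2 ∈ `GlobalAll`,
Thms 2.5.1, 3.2.1, 3.4.3 ∈ `LocalAll`, Prop 3.3.1 and Cor 3.5.2 ∈ `Ch3`, Lemmas 5.5.1/5.6.1 ∈ `Ch5`, Cor 7.4.7 and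
Prop 7.5.3 ∈ `LocalTemp` — hence a consequence of `Mok2015.Nodes.Everything` at all ranks [KMSW chap1mainthms.tex l.9-19; Mok l.4278]. [claim: KalethaMinguezShinWhite2014, under-review] -/
def E_ImportMok (μ : Mok2015.Nodes) (κ : Nodes) : Prop := (∀ N, μ.Everything N) → κ.MokMain

/-- D2 (dictionary edge KMSW → Mok): KMSW Appendix A (Prop A.3.2 / Cor A.3.3, node `KMSW2014.Nodes.AppA`) is the
statement Mok uses as "Proposition 8.2.5 [Ban]" for quasi-split unitary groups (Mok-module leaf `KMSW_AppA`)
[KMSW chap1mainthms.tex l.21; Mok l.8922-8930; AGIKMS arXiv:2410.13504v3 l.779-781]. [claim: KalethaMinguezShinWhite2014, under-review] -/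
def E_AppAtoMok (μ : Mok2015.Nodes) (κ : Nodes) : Prop := κ.AppA → μ.KMSW_AppA

/-- D3 (identification of a shared leaf): the general weighted fundamental lemma for Lie algebras ([W4, Conj. 3.6];
the unwritten Chaudouard–Laumon sequel) is the SAME statement under Mok (non-split U_{E/F}(N), AGIKMS l.986-990)
and under KMSW (inner twists, main.tex l.69 "the sequel is already needed in the quasi-split case"). [cite: AGIKMS2024, l.986-990] -/
def E_SameWFL (μ : Mok2015.Nodes) (κ : Nodes) : Prop := μ.WFL_general → κ.WFL_general

/-- The Mok-module leaf `KMSW_AppA` discharged down to KMSW's published inputs and KMSW's (preprint) Appendix A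
argument. [claim: KalethaMinguezShinWhite2014, under-review] -/
theorem mok_appA_of_kmsw (μ : Mok2015.Nodes) (κ : Nodes) (D2 : E_AppAtoMok μ κ)
    (S : κ.SupplyEdges) (P : κ.PublishedLeaves) : μ.KMSW_AppA :=
  D2 (κ.appA_of_leaves S P)

/-- JOINT BOOKKEEPING THEOREM.  Mok's section edges + supplies + leaves, the import edge D1, and KMSW's chapter
edges + supplies + leaves ⟹ KMSW's proved scope (`Scope N`: Theorem* 1.6.1 for generic parameters, Theorem* 2.6.2
for bounded parameters with E/F a field, Theorem 5.0.1 for generic ψ on pure inner twists) at every rank N. [claim: KalethaMinguezShinWhite2014, under-review] -/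
theorem scope_of_joint_leaves (μ : Mok2015.Nodes) (κ : Nodes) (D1 : E_ImportMok μ κ)
    (MB : μ.SectionEdges) (MS : μ.SupplyEdges) (MP : μ.PublishedLeaves) (MQ : μ.PreprintLeaves2026)
    (MU : μ.UnwrittenLeaves)
    (B : κ.ChapterEdges) (S : κ.SupplyEdges) (P : κ.PublishedLeaves) (U : κ.UnwrittenLeaves) :
    ∀ N, κ.Scope N :=
  κ.scope_of_leaves B S ⟨D1 (μ.everything_of_leaves MB MS MP MQ MU)⟩ P U

/-- The joint statement in conditional form: granted both papers' derivations, the published inputs and the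
2014–2026 preprints, KMSW's proved scope is CONDITIONAL EXACTLY ON the general and the non-standard weighted
fundamental lemmas (the general one entering twice, identified by D3). [cite: AGIKMS2024, l.380-382, 986-990 (bookkeeping proved here)] -/
theorem scope_joint_conditional_form (μ : Mok2015.Nodes) (κ : Nodes) (D1 : E_ImportMok μ κ) (D3 : E_SameWFL μ κ)
    (MB : μ.SectionEdges) (MS : μ.SupplyEdges) (MP : μ.PublishedLeaves) (MQ : μ.PreprintLeaves2026)
    (B : κ.ChapterEdges) (S : κ.SupplyEdges) (P : κ.PublishedLeaves) :
    μ.WFL_general → μ.WFL_nonstandard → ∀ N, κ.Scope N :=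
  fun h6 h7 => scope_of_joint_leaves μ κ D1 MB MS MP MQ ⟨h6, h7⟩ B S P ⟨D3 h6⟩

/-- FULL STATEMENTS, jointly: the starred theorems as stated need in addition the two unwritten sequels. [claim: KalethaMinguezShinWhite2014, under-review] -/
theorem full_of_joint_leaves (μ : Mok2015.Nodes) (κ : Nodes) (D1 : E_ImportMok μ κ)
    (MB : μ.SectionEdges) (MS : μ.SupplyEdges) (MP : μ.PublishedLeaves) (MQ : μ.PreprintLeaves2026)
    (MU : μ.UnwrittenLeaves)
    (B : κ.ChapterEdges) (S : κ.SupplyEdges) (P : κ.PublishedLeaves) (U : κ.UnwrittenLeaves)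
    (Q : κ.UnwrittenSequels) : ∀ N, κ.Full N :=
  κ.full_of_leaves B S ⟨D1 (μ.everything_of_leaves MB MS MP MQ MU)⟩ P U Q

end Literature.NumberTheory.Automorphic.KMSW2014
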